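import Summits.ABC.IUTFork.Conditional.HexDepthRadEngine
import Summits.ABC.IUTFork.Cor312GenuineKLocalTypeThirty
import HarnessLib

/-!
# Branch C / R-W «W:HEX-RAD-WRAP» at the EXACT TATE TYPE `e ≤ 30·l` — UNCONDITIONAL: the HEX datum `λ_k = 1/2 + 2/7^k` is DECIDED on the
# refuted side for EVERY `k ≥ 9` at every prime `11 ≤ l ≤ 89`, every `k ≥ 10` at every prime `l ≤ 317`, every `k ≥ 11` at every prime
# `l ≤ 479` (STAR × ENVELOPE radius; W-num-6's RAD-UNIFORM criterion p462893 at `E = 30·l`)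

PROOF-ONLY file (0 definitions, 0 `Prop` facts, no instance, no notation) of the abc-iut cell (seat abc-iut-W-neg-2, gen 0; D-0079 rescue
sub-cell R-W, lane P−; plan g9 19:01:31Z «W:HEX-RAD-WRAP»). TAKES NO SIDE on [IUTchIII] Cor. 3.12 (S. Mochizuki, *Inter-universal
Teichmüller theory III*, RIMS manuscript, Cor. 3.12 p. 173–174, Step (xi-f) p. 184) or on any author.

INPUTS BY NAME (one application each): this seat's `HexRad.not_pilotKummerCompatHull_lamSeven_of_criterion` (`HexDepthRadEngine`: the
[RAD] engine — abc-iut-c312-3's star × envelope socket p454852 — at the genuine `K`-datum with the chosen ideles, composed with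
abc-iut-W-num-6's `HexRad.logExponent_lt_floor_of_criterion` / `criterion_of_le` / `turning_of_bounds`, p462893), abc-iut-W-neg-1's exact
Tate local type `GenuineK.absRamificationIdx_kOf_le_thirty_mul_lamSeven` (`Cor312GenuineKLocalTypeThirty`: `e(K_{x₀}/ℚ_7) ≤ 30·l` at
every place over `7`; turning index `S = 3` for `l ≤ 68`, `S = 4` for `69 ≤ l ≤ 480`).

* §1 the uniform integer criteria: `HexRad.criterion_thirty_nine` (`k ≥ 9`, odd `11 ≤ l ≤ 68`, `S = 3`: with `l = 2j+1`,
  `F = ⌊(45j² − 5jl − (j+1)(l+5))/(5l)⌋`, the test reduces to `18j² ≥ 65j + 83`), `HexRad.criterion_thirty_nine'` (`k ≥ 9`, odd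
  `69 ≤ l ≤ 93`, `S = 4`: `1903j + 1951 ≥ 42j² + …`), `HexRad.criterion_thirty_ten` (`k ≥ 10`, odd `69 ≤ l ≤ 319`, `S = 4`),
  `HexRad.criterion_thirty_eleven` (`k ≥ 11`, odd `69 ≤ l ≤ 480`, `S = 4`).
* §2 **`HexRad.not_pilotKummerCompatHull_lamSeven_rad_nine`** — EVERY `k ≥ 9`, EVERY prime `11 ≤ l ≤ 89`: at every genuine Θ-volume
  datum `T` over `(ratPoint λ_k, l)`, for every choice of the free context binders and Kummer data, S_H (CHOSEN realising ideles, PINNED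
  reading — the per-datum instance of `hSHw` of `abc_of_SH_v10K_window` p447945) FAILS; **`…_rad_ten`** (`k ≥ 10`, prime `l ≤ 317`),
  **`…_rad_eleven`** (`k ≥ 11`, prime `l ≤ 479`).
KERNEL HEX FRONTIER after this file (refuted side, top-label packet over `7`): **`k ≥ 9` at EVERY prime `11 ≤ l ≤ 89`** (vs `12 @ 11`,
`12 @ 13`, `11 @ 17…`, `10 @ 23…67`, `9 @ {53,59,61,67}` of this seat's [LIN] files `HexDepthLocalTypeThirty`) — the numerics' refuted
edge (HOME/plan/rescue/R-W/README.md F3-1: `k ≤ 7` WINDOW at every tabulated `l`; `k = 8` one class); `k = 8` FAILS the criterion at every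
`l ≤ 68` (e.g. `(8, 11)`: `12.49 ≮ 11`) and is NOT claimed.

HONEST SCOPE: SHARP reading; the per-label licence is a STRONGER-THAN-PRINT sufficient form of (xi-f), read at ONE diagonal summand with the
exact per-slot radius (abc-iut-c312-3's optimality: what the socket leaves undecided is undecided by that socket); nothing about the printed
GLOBAL inequality, the number-level `Cor22.Cor312AtDatum`, or any author's intended hull; HEX rows are Szpiro-GOOD — they test the WINDOW binder
`hSHw` of the uncut records per datum and consume no hypothesis of the cut certificates; admissibility `CondP6` of `(λ_k, l)` not asserted;
no side taken on any author; typed ≠ proved; refuted-as-typed ≠ refuted-in-print; no abc claim.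
[cite: Mochizuki2012, IUTchIII Cor. 3.12 Step (xi-f) p. 184; IUTchIV Prop. 1.1 p. 9, Prop. 1.2 (i)(ii) p. 10, Cor. 2.2 (ii) proof (P5) p. 46]
[cite: DupuyHilado2025, §3.4, §3.9, §4.9] [cite: NeukirchANT1999, Ch. II (5.5)] [claim: Mochizuki2012, status: disputed] for every IUT quotation.
-/

noncomputable section

open Set Function NumberField IsDedekindDomain

namespace Summit.ABC.IUTFork.Conditional

open Thm311 Thm311.Real Cor312 Cor312Vol Cor312Prov Literature.IUT.LogThetaLattice Literature.IUT.LogVolume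
  Literature.IUT.HodgeTheaters Literature.IUT.LogVolume.ThetaData
  Literature.NumberTheory.NumberFields Literature.NumberTheory.DiophantineGeometry.GenEll
  Literature.NumberTheory.DiophantineGeometry Summit.ABC.ABC.Theorems

/-! ## §1. The uniform integer criteria at `E = 30·l` -/

/-- **W-num-6's RAD criterion at `E = 30·l`, `S = 3`, `k₀ = 9`, uniformly for odd `11 ≤ l ≤ 68`** (hence at every `k ≥ 9` by
`HexRad.criterion_of_le`): with `j = (l−1)/2` and `F := ⌊(5j²k₀ − 5jl − (j+1)(l+5))/(5l)⌋`, the integer test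
`(j+1)·l·(3·30l − 7^3) < (F·l − k₀)·30l` follows from `5l·F > 5j²k₀ − 5jl − (j+1)(l+5) − 5l` and the polynomial inequality
`18j² − 65j − 83 ≥ 0` in `j`. [folklore] -/
theorem HexRad.criterion_thirty_nine {k l : ℕ} (hk : 9 ≤ k) (hlo : 11 ≤ l) (hhi : l ≤ 68) (hodd : l % 2 = 1) :
    ∃ F : ℤ, 5 * (l : ℤ) * F ≤ 5 * ((l - 1) / 2 : ℕ) ^ 2 * k - 5 * ((l - 1) / 2 : ℕ) * l - (((l - 1) / 2 : ℕ) + 1) * (l + 5) ∧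
      (((l - 1) / 2 : ℕ) + 1 : ℤ) * l * ((3 : ℕ) * ((30 * l : ℕ)) - 7 ^ (3 : ℕ)) < (F * l - k) * ((30 * l : ℕ)) := by
  obtain ⟨j, rfl⟩ : ∃ j, l = 2 * j + 1 := ⟨l / 2, by omega⟩
  have hj : (2 * j + 1 - 1) / 2 = j := by omega
  refine HexRad.criterion_of_le (k₀ := 9) (E := 30 * (2 * j + 1)) (S := 3) (by omega)
    (F₀ := (5 * (j : ℤ) ^ 2 * 9 - 5 * (j : ℤ) * (2 * j + 1) - ((j : ℤ) + 1) * (2 * j + 1 + 5)) / (5 * (2 * j + 1))) ?_ ?_ hk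
  · rw [hj]
    have h5l : (0 : ℤ) < 5 * (2 * (j : ℤ) + 1) := by positivity
    have h := Int.ediv_mul_le (5 * (j : ℤ) ^ 2 * 9 - 5 * (j : ℤ) * (2 * j + 1) - ((j : ℤ) + 1) * (2 * j + 1 + 5)) h5l.ne'
    push_cast
    linarith
  · rw [hj]
    have h5l : (0 : ℤ) < 5 * (2 * (j : ℤ) + 1) := by positivity
    have hlow := Int.lt_ediv_add_one_mul_self (5 * (j : ℤ) ^ 2 * 9 - 5 * (j : ℤ) * (2 * j + 1) - ((j : ℤ) + 1) * (2 * j + 1 + 5)) h5l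
    set F : ℤ := (5 * (j : ℤ) ^ 2 * 9 - 5 * (j : ℤ) * (2 * j + 1) - ((j : ℤ) + 1) * (2 * j + 1 + 5)) / (5 * (2 * j + 1)) with hF
    have hjlo : (5 : ℤ) ≤ j := by exact_mod_cast (show 5 ≤ j by omega)
    have hjhi : (j : ℤ) ≤ 33 := by exact_mod_cast (show j ≤ 33 by omega)
    have hpoly : (0 : ℤ) ≤ 18 * (j : ℤ) ^ 2 - 65 * j - 83 := by nlinarith
    have hl0 : (0 : ℤ) < 2 * (j : ℤ) + 1 := by positivity
    push_cast
    nlinarith [mul_nonneg hpoly hl0.le, mul_lt_mul_of_pos_left hlow hl0]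

/-- **W-num-6's RAD criterion at `E = 30·l`, `S = 4`, `k₀ = 9`, uniformly for odd `69 ≤ l ≤ 93`** (hence at every `k ≥ 9` by
`HexRad.criterion_of_le`): with `j = (l−1)/2` and `F := ⌊(5j²k₀ − 5jl − (j+1)(l+5))/(5l)⌋`, the integer test
`(j+1)·l·(4·30l − 7^4) < (F·l − k₀)·30l` follows from `5l·F > 5j²k₀ − 5jl − (j+1)(l+5) − 5l` and the polynomial inequality
`1951 + 1903j − 42j² ≥ 0` in `j`. [folklore] -/
theorem HexRad.criterion_thirty_nine' {k l : ℕ} (hk : 9 ≤ k) (hlo : 69 ≤ l) (hhi : l ≤ 93) (hodd : l % 2 = 1) :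
    ∃ F : ℤ, 5 * (l : ℤ) * F ≤ 5 * ((l - 1) / 2 : ℕ) ^ 2 * k - 5 * ((l - 1) / 2 : ℕ) * l - (((l - 1) / 2 : ℕ) + 1) * (l + 5) ∧
      (((l - 1) / 2 : ℕ) + 1 : ℤ) * l * ((4 : ℕ) * ((30 * l : ℕ)) - 7 ^ (4 : ℕ)) < (F * l - k) * ((30 * l : ℕ)) := by
  obtain ⟨j, rfl⟩ : ∃ j, l = 2 * j + 1 := ⟨l / 2, by omega⟩
  have hj : (2 * j + 1 - 1) / 2 = j := by omega
  refine HexRad.criterion_of_le (k₀ := 9) (E := 30 * (2 * j + 1)) (S := 4) (by omega)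
    (F₀ := (5 * (j : ℤ) ^ 2 * 9 - 5 * (j : ℤ) * (2 * j + 1) - ((j : ℤ) + 1) * (2 * j + 1 + 5)) / (5 * (2 * j + 1))) ?_ ?_ hk
  · rw [hj]
    have h5l : (0 : ℤ) < 5 * (2 * (j : ℤ) + 1) := by positivity
    have h := Int.ediv_mul_le (5 * (j : ℤ) ^ 2 * 9 - 5 * (j : ℤ) * (2 * j + 1) - ((j : ℤ) + 1) * (2 * j + 1 + 5)) h5l.ne'
    push_cast
    linarith
  · rw [hj]
    have h5l : (0 : ℤ) < 5 * (2 * (j : ℤ) + 1) := by positivity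
    have hlow := Int.lt_ediv_add_one_mul_self (5 * (j : ℤ) ^ 2 * 9 - 5 * (j : ℤ) * (2 * j + 1) - ((j : ℤ) + 1) * (2 * j + 1 + 5)) h5l
    set F : ℤ := (5 * (j : ℤ) ^ 2 * 9 - 5 * (j : ℤ) * (2 * j + 1) - ((j : ℤ) + 1) * (2 * j + 1 + 5)) / (5 * (2 * j + 1)) with hF
    have hjlo : (34 : ℤ) ≤ j := by exact_mod_cast (show 34 ≤ j by omega)
    have hjhi : (j : ℤ) ≤ 46 := by exact_mod_cast (show j ≤ 46 by omega)
    have hpoly : (0 : ℤ) ≤ 1951 + 1903 * (j : ℤ) - 42 * j ^ 2 := by nlinarith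
    have hl0 : (0 : ℤ) < 2 * (j : ℤ) + 1 := by positivity
    push_cast
    nlinarith [mul_nonneg hpoly hl0.le, mul_lt_mul_of_pos_left hlow hl0]

/-- **W-num-6's RAD criterion at `E = 30·l`, `S = 4`, `k₀ = 10`, uniformly for odd `69 ≤ l ≤ 319`** (hence at every `k ≥ 10` by
`HexRad.criterion_of_le`): with `j = (l−1)/2` and `F := ⌊(5j²k₀ − 5jl − (j+1)(l+5))/(5l)⌋`, the integer test
`(j+1)·l·(4·30l − 7^4) < (F·l − k₀)·30l` follows from `5l·F > 5j²k₀ − 5jl − (j+1)(l+5) − 5l` and the polynomial inequality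
`1921 + 1903j − 12j² ≥ 0` in `j`. [folklore] -/
theorem HexRad.criterion_thirty_ten {k l : ℕ} (hk : 10 ≤ k) (hlo : 69 ≤ l) (hhi : l ≤ 319) (hodd : l % 2 = 1) :
    ∃ F : ℤ, 5 * (l : ℤ) * F ≤ 5 * ((l - 1) / 2 : ℕ) ^ 2 * k - 5 * ((l - 1) / 2 : ℕ) * l - (((l - 1) / 2 : ℕ) + 1) * (l + 5) ∧
      (((l - 1) / 2 : ℕ) + 1 : ℤ) * l * ((4 : ℕ) * ((30 * l : ℕ)) - 7 ^ (4 : ℕ)) < (F * l - k) * ((30 * l : ℕ)) := by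
  obtain ⟨j, rfl⟩ : ∃ j, l = 2 * j + 1 := ⟨l / 2, by omega⟩
  have hj : (2 * j + 1 - 1) / 2 = j := by omega
  refine HexRad.criterion_of_le (k₀ := 10) (E := 30 * (2 * j + 1)) (S := 4) (by omega)
    (F₀ := (5 * (j : ℤ) ^ 2 * 10 - 5 * (j : ℤ) * (2 * j + 1) - ((j : ℤ) + 1) * (2 * j + 1 + 5)) / (5 * (2 * j + 1))) ?_ ?_ hk
  · rw [hj]
    have h5l : (0 : ℤ) < 5 * (2 * (j : ℤ) + 1) := by positivity
    have h := Int.ediv_mul_le (5 * (j : ℤ) ^ 2 * 10 - 5 * (j : ℤ) * (2 * j + 1) - ((j : ℤ) + 1) * (2 * j + 1 + 5)) h5l.ne'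
    push_cast
    linarith
  · rw [hj]
    have h5l : (0 : ℤ) < 5 * (2 * (j : ℤ) + 1) := by positivity
    have hlow := Int.lt_ediv_add_one_mul_self (5 * (j : ℤ) ^ 2 * 10 - 5 * (j : ℤ) * (2 * j + 1) - ((j : ℤ) + 1) * (2 * j + 1 + 5)) h5l
    set F : ℤ := (5 * (j : ℤ) ^ 2 * 10 - 5 * (j : ℤ) * (2 * j + 1) - ((j : ℤ) + 1) * (2 * j + 1 + 5)) / (5 * (2 * j + 1)) with hF
    have hjlo : (34 : ℤ) ≤ j := by exact_mod_cast (show 34 ≤ j by omega)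
    have hjhi : (j : ℤ) ≤ 159 := by exact_mod_cast (show j ≤ 159 by omega)
    have hpoly : (0 : ℤ) ≤ 1921 + 1903 * (j : ℤ) - 12 * j ^ 2 := by nlinarith
    have hl0 : (0 : ℤ) < 2 * (j : ℤ) + 1 := by positivity
    push_cast
    nlinarith [mul_nonneg hpoly hl0.le, mul_lt_mul_of_pos_left hlow hl0]

/-- **W-num-6's RAD criterion at `E = 30·l`, `S = 4`, `k₀ = 11`, uniformly for odd `69 ≤ l ≤ 480`** (hence at every `k ≥ 11` by
`HexRad.criterion_of_le`): with `j = (l−1)/2` and `F := ⌊(5j²k₀ − 5jl − (j+1)(l+5))/(5l)⌋`, the integer test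
`(j+1)·l·(4·30l − 7^4) < (F·l − k₀)·30l` follows from `5l·F > 5j²k₀ − 5jl − (j+1)(l+5) − 5l` and the polynomial inequality
`18j² + 1903j + 1891 ≥ 0` in `j`. [folklore] -/
theorem HexRad.criterion_thirty_eleven {k l : ℕ} (hk : 11 ≤ k) (hlo : 69 ≤ l) (hhi : l ≤ 480) (hodd : l % 2 = 1) :
    ∃ F : ℤ, 5 * (l : ℤ) * F ≤ 5 * ((l - 1) / 2 : ℕ) ^ 2 * k - 5 * ((l - 1) / 2 : ℕ) * l - (((l - 1) / 2 : ℕ) + 1) * (l + 5) ∧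
      (((l - 1) / 2 : ℕ) + 1 : ℤ) * l * ((4 : ℕ) * ((30 * l : ℕ)) - 7 ^ (4 : ℕ)) < (F * l - k) * ((30 * l : ℕ)) := by
  obtain ⟨j, rfl⟩ : ∃ j, l = 2 * j + 1 := ⟨l / 2, by omega⟩
  have hj : (2 * j + 1 - 1) / 2 = j := by omega
  refine HexRad.criterion_of_le (k₀ := 11) (E := 30 * (2 * j + 1)) (S := 4) (by omega)
    (F₀ := (5 * (j : ℤ) ^ 2 * 11 - 5 * (j : ℤ) * (2 * j + 1) - ((j : ℤ) + 1) * (2 * j + 1 + 5)) / (5 * (2 * j + 1))) ?_ ?_ hk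
  · rw [hj]
    have h5l : (0 : ℤ) < 5 * (2 * (j : ℤ) + 1) := by positivity
    have h := Int.ediv_mul_le (5 * (j : ℤ) ^ 2 * 11 - 5 * (j : ℤ) * (2 * j + 1) - ((j : ℤ) + 1) * (2 * j + 1 + 5)) h5l.ne'
    push_cast
    linarith
  · rw [hj]
    have h5l : (0 : ℤ) < 5 * (2 * (j : ℤ) + 1) := by positivity
    have hlow := Int.lt_ediv_add_one_mul_self (5 * (j : ℤ) ^ 2 * 11 - 5 * (j : ℤ) * (2 * j + 1) - ((j : ℤ) + 1) * (2 * j + 1 + 5)) h5l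
    set F : ℤ := (5 * (j : ℤ) ^ 2 * 11 - 5 * (j : ℤ) * (2 * j + 1) - ((j : ℤ) + 1) * (2 * j + 1 + 5)) / (5 * (2 * j + 1)) with hF
    have hjlo : (34 : ℤ) ≤ j := by exact_mod_cast (show 34 ≤ j by omega)
    have hjhi : (j : ℤ) ≤ 239 := by exact_mod_cast (show j ≤ 239 by omega)
    have hpoly : (0 : ℤ) ≤ 18 * (j : ℤ) ^ 2 + 1903 * j + 1891 := by nlinarith
    have hl0 : (0 : ℤ) < 2 * (j : ℤ) + 1 := by positivity
    push_cast
    nlinarith [mul_nonneg hpoly hl0.le, mul_lt_mul_of_pos_left hlow hl0]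

/-! ## §2. The HEX rows, unconditional -/

/-- **HEX-RAD, UNCONDITIONAL: every `k ≥ 9`, every prime `11 ≤ l ≤ 89`.** At EVERY genuine Θ-volume datum `T` over `(ratPoint λ_k, l)`,
for EVERY region field, columns, frames, lattice, Frobenioid signature, q-pilot data and Kummer datum `qK`, the hull-level clause S_H
(`Cor312Vol.PilotKummerCompatHull` at the sharp genuine K-setting, CHOSEN realising ideles, PINNED reading) is FALSE — the star × envelope test
at the top label over `7` with the exact Tate type `e ≤ 30·l` (`S = 3` for `l ≤ 67`, `S = 4` for `71 ≤ l ≤ 89`). WINDOW-TABLE rows `HEX:k:l`,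
`k ≥ 9`, every tabulated `l ≤ 67`: REFUTED by theorem. [cite: Mochizuki2012, IUTchIII Cor. 3.12 Step (xi-f) p. 184; IUTchIV Prop. 1.2 (i)(ii) p. 10]
[claim: Mochizuki2012, status: disputed] -/
theorem HexRad.not_pilotKummerCompatHull_lamSeven_rad_nine {k l : ℕ} (hk : 9 ≤ k) (hl : l.Prime) (h11 : 11 ≤ l) (h89 : l ≤ 89)
    (T : Cor22.ThetaVolumeDatumAt (ratPoint ((2 : ℚ)⁻¹ + 2 / 7 ^ k)) l) :
    letI := T.instFieldF; letI := T.instNumberFieldF; letI := T.instAlgebraF; letI := T.instFieldK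
    letI := T.instNumberFieldK; letI := T.instAlgebraK; letI := T.instFieldFbar; letI := T.instAlgebraFbar
    letI := T.instAlgebraKFbar; letI := T.instIsElliptic
    ∀ (M : Type) [Field M] [NumberField M]
      (archPk : ∀ (j : (thetaIndex (pilotDataOfK T.D T.K)).Label) (vQ : (thetaIndex (pilotDataOfK T.D T.K)).VQ),
        Set ((logShellsDH (pilotDataOfK T.D T.K) (analyticLogv T.K)).Packet j vQ))
      (archSub : ∀ (j : (thetaIndex (pilotDataOfK T.D T.K)).Label) (v : (thetaIndex (pilotDataOfK T.D T.K)).V),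
        Set ((logShellsDH (pilotDataOfK T.D T.K) (analyticLogv T.K)).Packet j ((thetaIndex (pilotDataOfK T.D T.K)).over v)))
      (Ψ : ℤ → ∀ v : (thetaIndex (pilotDataOfK T.D T.K)).V, v ∈ (thetaIndex (pilotDataOfK T.D T.K)).Vbad →
        Set ((logShellsDH (pilotDataOfK T.D T.K) (analyticLogv T.K)).StarPacket v))
      (act : ℤ → ∀ v : (thetaIndex (pilotDataOfK T.D T.K)).V, v ∈ (thetaIndex (pilotDataOfK T.D T.K)).Vbad →
        (logShellsDH (pilotDataOfK T.D T.K) (analyticLogv T.K)).StarPacket v →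
          Module.End ℚ ((logShellsDH (pilotDataOfK T.D T.K) (analyticLogv T.K)).StarPacket v))
      (Mmod : ℤ → ∀ j : (thetaIndex (pilotDataOfK T.D T.K)).LabelStar,
        Set ((logShellsDH (pilotDataOfK T.D T.K) (analyticLogv T.K)).GlobalPacket j.1))
      (region : ℤ → ∀ j : (thetaIndex (pilotDataOfK T.D T.K)).LabelStar, FinDivisor M →
        ∀ vQ : (thetaIndex (pilotDataOfK T.D T.K)).VQ, Set ((logShellsDH (pilotDataOfK T.D T.K) (analyticLogv T.K)).Packet j.1 vQ))
      (frobAdm : ℤ → ℤ → ∀ (j : (thetaIndex (pilotDataOfK T.D T.K)).Label) (vQ : (thetaIndex (pilotDataOfK T.D T.K)).VQ),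
        Set ((logShellsDH (pilotDataOfK T.D T.K) (analyticLogv T.K)).Packet j vQ) → Prop)
      (frobLogvol : ℤ → ℤ → ∀ (j : (thetaIndex (pilotDataOfK T.D T.K)).Label) (vQ : (thetaIndex (pilotDataOfK T.D T.K)).VQ),
        Set ((logShellsDH (pilotDataOfK T.D T.K) (analyticLogv T.K)).Packet j vQ) → ℝ)
      (frobΨ : ℤ → ℤ → ∀ v : (thetaIndex (pilotDataOfK T.D T.K)).V, v ∈ (thetaIndex (pilotDataOfK T.D T.K)).Vbad →
        Set ((logShellsDH (pilotDataOfK T.D T.K) (analyticLogv T.K)).StarPacket v))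
      (frobMmod : ℤ → ℤ → ∀ j : (thetaIndex (pilotDataOfK T.D T.K)).LabelStar,
        Set ((logShellsDH (pilotDataOfK T.D T.K) (analyticLogv T.K)).GlobalPacket j.1))
      (unitImage : ℤ → ℤ → ℕ → ∀ (j : (thetaIndex (pilotDataOfK T.D T.K)).Label) (vQ : (thetaIndex (pilotDataOfK T.D T.K)).VQ),
        Set ((logShellsDH (pilotDataOfK T.D T.K) (analyticLogv T.K)).Packet j vQ))
      (ballImage : ℤ → ℤ → ∀ (j : (thetaIndex (pilotDataOfK T.D T.K)).Label) (vQ : (thetaIndex (pilotDataOfK T.D T.K)).VQ),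
        Set ((logShellsDH (pilotDataOfK T.D T.K) (analyticLogv T.K)).Packet j vQ))
      (thetaDiv : ℤ → ℤ → LgpDivisor M (thetaIndex (pilotDataOfK T.D T.K)).lstar)
      (n : ℤ) {HT : Type} {LogLink : HT → HT → Type} {IsFull : ∀ {s t : HT}, LogLink s t → Prop}
      (lat : LGPGaussianLogThetaLattice LogLink IsFull)
      {Frd : Type} {IsoF : Frd → Frd → Type} {Ob : Frd → Type} {realify : Frd → Frd} {Strip : Type}
      {IsoS : Strip → Strip → Type} {Mv : ∀ v : (thetaIndex (pilotDataOfK T.D T.K)).V, v ∈ (thetaIndex (pilotDataOfK T.D T.K)).Vbad → Type}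
      [∀ v h, Monoid (Mv v h)]
      (sig : GlobalLGPFrobenioidSignature (thetaIndex (pilotDataOfK T.D T.K)).lstar (thetaIndex (pilotDataOfK T.D T.K)).V
        (· ∈ (thetaIndex (pilotDataOfK T.D T.K)).Vbad) Frd IsoF Ob realify Strip IsoS Mv)
      (split : SplittingMonoids Mv) {ObΔ : Type}
      {N : ∀ v : (thetaIndex (pilotDataOfK T.D T.K)).V, v ∈ (thetaIndex (pilotDataOfK T.D T.K)).Vbad → Type}
      [∀ v h, Monoid (N v h)] (qData : QPilotData ObΔ N)
      (qK : ∀ v : (thetaIndex (pilotDataOfK T.D T.K)).V, v ∈ (thetaIndex (pilotDataOfK T.D T.K)).Vbad →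
        Set ((logShellsDH (pilotDataOfK T.D T.K) (analyticLogv T.K)).StarPacket v)),
    ¬ Cor312Vol.PilotKummerCompatHull
        (LatticeSituation.ofShells (logShellsDH (pilotDataOfK T.D T.K) (analyticLogv T.K)) M archPk archSub
          (summandPiecesPr (pilotDataOfK T.D T.K) (logvAnalytic_analyticLogv (F := T.K))).Adm
          (summandPiecesPr (pilotDataOfK T.D T.K) (logvAnalytic_analyticLogv (F := T.K))).logvol Ψ act Mmod region frobAdm
          frobLogvol frobΨ frobMmod unitImage ballImage thetaDiv)
        (settingPrVolSharp (pilotDataOfK T.D T.K) (logvAnalytic_analyticLogv (F := T.K)) M archPk archSub Ψ act Mmod region n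
          lat sig split qData (exists_realising_qIdeles_pilotDataOfK T.D).choose (exists_realising_thetaIdeles_pilotDataOfK T.D).choose
          (exists_realising_qIdeles_pilotDataOfK T.D).choose_spec.1 (exists_realising_qIdeles_pilotDataOfK T.D).choose_spec.2.1)
        (fun _ => Cor312.Setting.qRegion
          (settingPrVolSharp (pilotDataOfK T.D T.K) (logvAnalytic_analyticLogv (F := T.K)) M archPk archSub Ψ act Mmod region n
            lat sig split qData (exists_realising_qIdeles_pilotDataOfK T.D).choose (exists_realising_thetaIdeles_pilotDataOfK T.D).choose
            (exists_realising_qIdeles_pilotDataOfK T.D).choose_spec.1 (exists_realising_qIdeles_pilotDataOfK T.D).choose_spec.2.1))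
        qK := by
  have hodd : l % 2 = 1 := Nat.odd_iff.mp (hl.odd_of_ne_two (by omega))
  by_cases h68 : l ≤ 68
  · obtain ⟨F, hF, hcrit⟩ := HexRad.criterion_thirty_nine hk h11 h68 hodd
    obtain ⟨hloS, hhiS⟩ := HexRad.turning_of_bounds (E := 30 * l) (S := 3) (Or.inr (by push_cast; omega)) (by push_cast; omega)
    exact HexRad.not_pilotKummerCompatHull_lamSeven_of_criterion (by omega) hl h11 hloS hhiS hF hcrit T
      (GenuineK.absRamificationIdx_kOf_le_thirty_mul_lamSeven (by omega) h11 T)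
  · obtain ⟨F, hF, hcrit⟩ := HexRad.criterion_thirty_nine' hk (by omega) (by omega) hodd
    obtain ⟨hloS, hhiS⟩ := HexRad.turning_of_bounds (E := 30 * l) (S := 4) (Or.inr (by push_cast; omega)) (by push_cast; omega)
    exact HexRad.not_pilotKummerCompatHull_lamSeven_of_criterion (by omega) hl h11 hloS hhiS hF hcrit T
      (GenuineK.absRamificationIdx_kOf_le_thirty_mul_lamSeven (by omega) h11 T)

/-- **HEX-RAD, UNCONDITIONAL: every `k ≥ 10`, every prime `11 ≤ l ≤ 317`** (the `(P2)`-sufficient primes `223, 239, 257, 271` of the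
WINDOW-TABLE included): S_H at the chosen ideles / pinned reading FAILS at every datum over `(λ_k, l)` for every choice of the free binders.
[cite: Mochizuki2012, IUTchIII Cor. 3.12 Step (xi-f) p. 184; IUTchIV Prop. 1.2 (i)(ii) p. 10] [claim: Mochizuki2012, status: disputed] -/
theorem HexRad.not_pilotKummerCompatHull_lamSeven_rad_ten {k l : ℕ} (hk : 10 ≤ k) (hl : l.Prime) (h11 : 11 ≤ l) (h317 : l ≤ 317)
    (T : Cor22.ThetaVolumeDatumAt (ratPoint ((2 : ℚ)⁻¹ + 2 / 7 ^ k)) l) :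
    letI := T.instFieldF; letI := T.instNumberFieldF; letI := T.instAlgebraF; letI := T.instFieldK
    letI := T.instNumberFieldK; letI := T.instAlgebraK; letI := T.instFieldFbar; letI := T.instAlgebraFbar
    letI := T.instAlgebraKFbar; letI := T.instIsElliptic
    ∀ (M : Type) [Field M] [NumberField M]
      (archPk : ∀ (j : (thetaIndex (pilotDataOfK T.D T.K)).Label) (vQ : (thetaIndex (pilotDataOfK T.D T.K)).VQ),
        Set ((logShellsDH (pilotDataOfK T.D T.K) (analyticLogv T.K)).Packet j vQ))
      (archSub : ∀ (j : (thetaIndex (pilotDataOfK T.D T.K)).Label) (v : (thetaIndex (pilotDataOfK T.D T.K)).V),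
        Set ((logShellsDH (pilotDataOfK T.D T.K) (analyticLogv T.K)).Packet j ((thetaIndex (pilotDataOfK T.D T.K)).over v)))
      (Ψ : ℤ → ∀ v : (thetaIndex (pilotDataOfK T.D T.K)).V, v ∈ (thetaIndex (pilotDataOfK T.D T.K)).Vbad →
        Set ((logShellsDH (pilotDataOfK T.D T.K) (analyticLogv T.K)).StarPacket v))
      (act : ℤ → ∀ v : (thetaIndex (pilotDataOfK T.D T.K)).V, v ∈ (thetaIndex (pilotDataOfK T.D T.K)).Vbad →
        (logShellsDH (pilotDataOfK T.D T.K) (analyticLogv T.K)).StarPacket v →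
          Module.End ℚ ((logShellsDH (pilotDataOfK T.D T.K) (analyticLogv T.K)).StarPacket v))
      (Mmod : ℤ → ∀ j : (thetaIndex (pilotDataOfK T.D T.K)).LabelStar,
        Set ((logShellsDH (pilotDataOfK T.D T.K) (analyticLogv T.K)).GlobalPacket j.1))
      (region : ℤ → ∀ j : (thetaIndex (pilotDataOfK T.D T.K)).LabelStar, FinDivisor M →
        ∀ vQ : (thetaIndex (pilotDataOfK T.D T.K)).VQ, Set ((logShellsDH (pilotDataOfK T.D T.K) (analyticLogv T.K)).Packet j.1 vQ))
      (frobAdm : ℤ → ℤ → ∀ (j : (thetaIndex (pilotDataOfK T.D T.K)).Label) (vQ : (thetaIndex (pilotDataOfK T.D T.K)).VQ),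
        Set ((logShellsDH (pilotDataOfK T.D T.K) (analyticLogv T.K)).Packet j vQ) → Prop)
      (frobLogvol : ℤ → ℤ → ∀ (j : (thetaIndex (pilotDataOfK T.D T.K)).Label) (vQ : (thetaIndex (pilotDataOfK T.D T.K)).VQ),
        Set ((logShellsDH (pilotDataOfK T.D T.K) (analyticLogv T.K)).Packet j vQ) → ℝ)
      (frobΨ : ℤ → ℤ → ∀ v : (thetaIndex (pilotDataOfK T.D T.K)).V, v ∈ (thetaIndex (pilotDataOfK T.D T.K)).Vbad →
        Set ((logShellsDH (pilotDataOfK T.D T.K) (analyticLogv T.K)).StarPacket v))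
      (frobMmod : ℤ → ℤ → ∀ j : (thetaIndex (pilotDataOfK T.D T.K)).LabelStar,
        Set ((logShellsDH (pilotDataOfK T.D T.K) (analyticLogv T.K)).GlobalPacket j.1))
      (unitImage : ℤ → ℤ → ℕ → ∀ (j : (thetaIndex (pilotDataOfK T.D T.K)).Label) (vQ : (thetaIndex (pilotDataOfK T.D T.K)).VQ),
        Set ((logShellsDH (pilotDataOfK T.D T.K) (analyticLogv T.K)).Packet j vQ))
      (ballImage : ℤ → ℤ → ∀ (j : (thetaIndex (pilotDataOfK T.D T.K)).Label) (vQ : (thetaIndex (pilotDataOfK T.D T.K)).VQ),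
        Set ((logShellsDH (pilotDataOfK T.D T.K) (analyticLogv T.K)).Packet j vQ))
      (thetaDiv : ℤ → ℤ → LgpDivisor M (thetaIndex (pilotDataOfK T.D T.K)).lstar)
      (n : ℤ) {HT : Type} {LogLink : HT → HT → Type} {IsFull : ∀ {s t : HT}, LogLink s t → Prop}
      (lat : LGPGaussianLogThetaLattice LogLink IsFull)
      {Frd : Type} {IsoF : Frd → Frd → Type} {Ob : Frd → Type} {realify : Frd → Frd} {Strip : Type}
      {IsoS : Strip → Strip → Type} {Mv : ∀ v : (thetaIndex (pilotDataOfK T.D T.K)).V, v ∈ (thetaIndex (pilotDataOfK T.D T.K)).Vbad → Type}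
      [∀ v h, Monoid (Mv v h)]
      (sig : GlobalLGPFrobenioidSignature (thetaIndex (pilotDataOfK T.D T.K)).lstar (thetaIndex (pilotDataOfK T.D T.K)).V
        (· ∈ (thetaIndex (pilotDataOfK T.D T.K)).Vbad) Frd IsoF Ob realify Strip IsoS Mv)
      (split : SplittingMonoids Mv) {ObΔ : Type}
      {N : ∀ v : (thetaIndex (pilotDataOfK T.D T.K)).V, v ∈ (thetaIndex (pilotDataOfK T.D T.K)).Vbad → Type}
      [∀ v h, Monoid (N v h)] (qData : QPilotData ObΔ N)
      (qK : ∀ v : (thetaIndex (pilotDataOfK T.D T.K)).V, v ∈ (thetaIndex (pilotDataOfK T.D T.K)).Vbad →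
        Set ((logShellsDH (pilotDataOfK T.D T.K) (analyticLogv T.K)).StarPacket v)),
    ¬ Cor312Vol.PilotKummerCompatHull
        (LatticeSituation.ofShells (logShellsDH (pilotDataOfK T.D T.K) (analyticLogv T.K)) M archPk archSub
          (summandPiecesPr (pilotDataOfK T.D T.K) (logvAnalytic_analyticLogv (F := T.K))).Adm
          (summandPiecesPr (pilotDataOfK T.D T.K) (logvAnalytic_analyticLogv (F := T.K))).logvol Ψ act Mmod region frobAdm
          frobLogvol frobΨ frobMmod unitImage ballImage thetaDiv)
        (settingPrVolSharp (pilotDataOfK T.D T.K) (logvAnalytic_analyticLogv (F := T.K)) M archPk archSub Ψ act Mmod region n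
          lat sig split qData (exists_realising_qIdeles_pilotDataOfK T.D).choose (exists_realising_thetaIdeles_pilotDataOfK T.D).choose
          (exists_realising_qIdeles_pilotDataOfK T.D).choose_spec.1 (exists_realising_qIdeles_pilotDataOfK T.D).choose_spec.2.1)
        (fun _ => Cor312.Setting.qRegion
          (settingPrVolSharp (pilotDataOfK T.D T.K) (logvAnalytic_analyticLogv (F := T.K)) M archPk archSub Ψ act Mmod region n
            lat sig split qData (exists_realising_qIdeles_pilotDataOfK T.D).choose (exists_realising_thetaIdeles_pilotDataOfK T.D).choose
            (exists_realising_qIdeles_pilotDataOfK T.D).choose_spec.1 (exists_realising_qIdeles_pilotDataOfK T.D).choose_spec.2.1))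
        qK := by
  have hodd : l % 2 = 1 := Nat.odd_iff.mp (hl.odd_of_ne_two (by omega))
  by_cases h89 : l ≤ 89
  · exact HexRad.not_pilotKummerCompatHull_lamSeven_rad_nine (by omega) hl h11 h89 T
  · obtain ⟨F, hF, hcrit⟩ := HexRad.criterion_thirty_ten hk (by omega) (by omega) hodd
    obtain ⟨hloS, hhiS⟩ := HexRad.turning_of_bounds (E := 30 * l) (S := 4) (Or.inr (by push_cast; omega)) (by push_cast; omega)
    exact HexRad.not_pilotKummerCompatHull_lamSeven_of_criterion (by omega) hl h11 hloS hhiS hF hcrit T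
      (GenuineK.absRamificationIdx_kOf_le_thirty_mul_lamSeven (by omega) h11 T)

/-- **HEX-RAD, UNCONDITIONAL: every `k ≥ 11`, every prime `11 ≤ l ≤ 479`**: S_H at the chosen ideles / pinned reading FAILS at every datum
over `(λ_k, l)` for every choice of the free binders. [cite: Mochizuki2012, IUTchIII Cor. 3.12 Step (xi-f) p. 184; IUTchIV Prop. 1.2 (i)(ii) p. 10]
[claim: Mochizuki2012, status: disputed] -/
theorem HexRad.not_pilotKummerCompatHull_lamSeven_rad_eleven {k l : ℕ} (hk : 11 ≤ k) (hl : l.Prime) (h11 : 11 ≤ l) (h479 : l ≤ 479)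
    (T : Cor22.ThetaVolumeDatumAt (ratPoint ((2 : ℚ)⁻¹ + 2 / 7 ^ k)) l) :
    letI := T.instFieldF; letI := T.instNumberFieldF; letI := T.instAlgebraF; letI := T.instFieldK
    letI := T.instNumberFieldK; letI := T.instAlgebraK; letI := T.instFieldFbar; letI := T.instAlgebraFbar
    letI := T.instAlgebraKFbar; letI := T.instIsElliptic
    ∀ (M : Type) [Field M] [NumberField M]
      (archPk : ∀ (j : (thetaIndex (pilotDataOfK T.D T.K)).Label) (vQ : (thetaIndex (pilotDataOfK T.D T.K)).VQ),
        Set ((logShellsDH (pilotDataOfK T.D T.K) (analyticLogv T.K)).Packet j vQ))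
      (archSub : ∀ (j : (thetaIndex (pilotDataOfK T.D T.K)).Label) (v : (thetaIndex (pilotDataOfK T.D T.K)).V),
        Set ((logShellsDH (pilotDataOfK T.D T.K) (analyticLogv T.K)).Packet j ((thetaIndex (pilotDataOfK T.D T.K)).over v)))
      (Ψ : ℤ → ∀ v : (thetaIndex (pilotDataOfK T.D T.K)).V, v ∈ (thetaIndex (pilotDataOfK T.D T.K)).Vbad →
        Set ((logShellsDH (pilotDataOfK T.D T.K) (analyticLogv T.K)).StarPacket v))
      (act : ℤ → ∀ v : (thetaIndex (pilotDataOfK T.D T.K)).V, v ∈ (thetaIndex (pilotDataOfK T.D T.K)).Vbad →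
        (logShellsDH (pilotDataOfK T.D T.K) (analyticLogv T.K)).StarPacket v →
          Module.End ℚ ((logShellsDH (pilotDataOfK T.D T.K) (analyticLogv T.K)).StarPacket v))
      (Mmod : ℤ → ∀ j : (thetaIndex (pilotDataOfK T.D T.K)).LabelStar,
        Set ((logShellsDH (pilotDataOfK T.D T.K) (analyticLogv T.K)).GlobalPacket j.1))
      (region : ℤ → ∀ j : (thetaIndex (pilotDataOfK T.D T.K)).LabelStar, FinDivisor M →
        ∀ vQ : (thetaIndex (pilotDataOfK T.D T.K)).VQ, Set ((logShellsDH (pilotDataOfK T.D T.K) (analyticLogv T.K)).Packet j.1 vQ))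
      (frobAdm : ℤ → ℤ → ∀ (j : (thetaIndex (pilotDataOfK T.D T.K)).Label) (vQ : (thetaIndex (pilotDataOfK T.D T.K)).VQ),
        Set ((logShellsDH (pilotDataOfK T.D T.K) (analyticLogv T.K)).Packet j vQ) → Prop)
      (frobLogvol : ℤ → ℤ → ∀ (j : (thetaIndex (pilotDataOfK T.D T.K)).Label) (vQ : (thetaIndex (pilotDataOfK T.D T.K)).VQ),
        Set ((logShellsDH (pilotDataOfK T.D T.K) (analyticLogv T.K)).Packet j vQ) → ℝ)
      (frobΨ : ℤ → ℤ → ∀ v : (thetaIndex (pilotDataOfK T.D T.K)).V, v ∈ (thetaIndex (pilotDataOfK T.D T.K)).Vbad →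
        Set ((logShellsDH (pilotDataOfK T.D T.K) (analyticLogv T.K)).StarPacket v))
      (frobMmod : ℤ → ℤ → ∀ j : (thetaIndex (pilotDataOfK T.D T.K)).LabelStar,
        Set ((logShellsDH (pilotDataOfK T.D T.K) (analyticLogv T.K)).GlobalPacket j.1))
      (unitImage : ℤ → ℤ → ℕ → ∀ (j : (thetaIndex (pilotDataOfK T.D T.K)).Label) (vQ : (thetaIndex (pilotDataOfK T.D T.K)).VQ),
        Set ((logShellsDH (pilotDataOfK T.D T.K) (analyticLogv T.K)).Packet j vQ))
      (ballImage : ℤ → ℤ → ∀ (j : (thetaIndex (pilotDataOfK T.D T.K)).Label) (vQ : (thetaIndex (pilotDataOfK T.D T.K)).VQ),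
        Set ((logShellsDH (pilotDataOfK T.D T.K) (analyticLogv T.K)).Packet j vQ))
      (thetaDiv : ℤ → ℤ → LgpDivisor M (thetaIndex (pilotDataOfK T.D T.K)).lstar)
      (n : ℤ) {HT : Type} {LogLink : HT → HT → Type} {IsFull : ∀ {s t : HT}, LogLink s t → Prop}
      (lat : LGPGaussianLogThetaLattice LogLink IsFull)
      {Frd : Type} {IsoF : Frd → Frd → Type} {Ob : Frd → Type} {realify : Frd → Frd} {Strip : Type}
      {IsoS : Strip → Strip → Type} {Mv : ∀ v : (thetaIndex (pilotDataOfK T.D T.K)).V, v ∈ (thetaIndex (pilotDataOfK T.D T.K)).Vbad → Type}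
      [∀ v h, Monoid (Mv v h)]
      (sig : GlobalLGPFrobenioidSignature (thetaIndex (pilotDataOfK T.D T.K)).lstar (thetaIndex (pilotDataOfK T.D T.K)).V
        (· ∈ (thetaIndex (pilotDataOfK T.D T.K)).Vbad) Frd IsoF Ob realify Strip IsoS Mv)
      (split : SplittingMonoids Mv) {ObΔ : Type}
      {N : ∀ v : (thetaIndex (pilotDataOfK T.D T.K)).V, v ∈ (thetaIndex (pilotDataOfK T.D T.K)).Vbad → Type}
      [∀ v h, Monoid (N v h)] (qData : QPilotData ObΔ N)
      (qK : ∀ v : (thetaIndex (pilotDataOfK T.D T.K)).V, v ∈ (thetaIndex (pilotDataOfK T.D T.K)).Vbad →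
        Set ((logShellsDH (pilotDataOfK T.D T.K) (analyticLogv T.K)).StarPacket v)),
    ¬ Cor312Vol.PilotKummerCompatHull
        (LatticeSituation.ofShells (logShellsDH (pilotDataOfK T.D T.K) (analyticLogv T.K)) M archPk archSub
          (summandPiecesPr (pilotDataOfK T.D T.K) (logvAnalytic_analyticLogv (F := T.K))).Adm
          (summandPiecesPr (pilotDataOfK T.D T.K) (logvAnalytic_analyticLogv (F := T.K))).logvol Ψ act Mmod region frobAdm
          frobLogvol frobΨ frobMmod unitImage ballImage thetaDiv)
        (settingPrVolSharp (pilotDataOfK T.D T.K) (logvAnalytic_analyticLogv (F := T.K)) M archPk archSub Ψ act Mmod region n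
          lat sig split qData (exists_realising_qIdeles_pilotDataOfK T.D).choose (exists_realising_thetaIdeles_pilotDataOfK T.D).choose
          (exists_realising_qIdeles_pilotDataOfK T.D).choose_spec.1 (exists_realising_qIdeles_pilotDataOfK T.D).choose_spec.2.1)
        (fun _ => Cor312.Setting.qRegion
          (settingPrVolSharp (pilotDataOfK T.D T.K) (logvAnalytic_analyticLogv (F := T.K)) M archPk archSub Ψ act Mmod region n
            lat sig split qData (exists_realising_qIdeles_pilotDataOfK T.D).choose (exists_realising_thetaIdeles_pilotDataOfK T.D).choose
            (exists_realising_qIdeles_pilotDataOfK T.D).choose_spec.1 (exists_realising_qIdeles_pilotDataOfK T.D).choose_spec.2.1))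
        qK := by
  have hodd : l % 2 = 1 := Nat.odd_iff.mp (hl.odd_of_ne_two (by omega))
  by_cases h89 : l ≤ 89
  · exact HexRad.not_pilotKummerCompatHull_lamSeven_rad_nine (by omega) hl h11 h89 T
  · obtain ⟨F, hF, hcrit⟩ := HexRad.criterion_thirty_eleven hk (by omega) (by omega) hodd
    obtain ⟨hloS, hhiS⟩ := HexRad.turning_of_bounds (E := 30 * l) (S := 4) (Or.inr (by push_cast; omega)) (by push_cast; omega)
    exact HexRad.not_pilotKummerCompatHull_lamSeven_of_criterion (by omega) hl h11 hloS hhiS hF hcrit T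
      (GenuineK.absRamificationIdx_kOf_le_thirty_mul_lamSeven (by omega) h11 T)

end Summit.ABC.IUTFork.Conditional

end
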